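import Literature.MathematicalPhysics.QuantumFieldTheory.Balaban1983to89.B13Core214Holomorphic

/-!
# `Balaban1983to89.B13Core214HolomorphicPrimitive` — T. Bałaban, *Renormalization group approach to lattice gauge field
theories. II. Cluster expansions*, Commun. Math. Phys. **116** (1988) 1–22 [Balaban1988RG2Cluster], p. 15: the σ-analyticity
of the `X`-integral of (2.14) FROM THE PRIMITIVE OBJECTS of the tree's (2.26) capstone
(`B13Bound226Located.norm_term214_le_226_of_primitives`) — so the regularity slot `hΨσ` of that capstone is a consequence of its
OTHER hypotheses (stated on an open σ-polydisc) plus entrywise holomorphy of the primitive kernels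

statement-level skeleton of published theorems with citation tags; proofs where landed; nothing here is a claim about
the Yang–Mills mass gap

CITATION HEADER (verbatim).  P. 15 [PDF 15]: *"We consider it as an analytic function … of the complex parameters σ(Z), τ,
and we estimate it using the Cauchy formula"*; p. 15: *"The quadratic forms and covariances in H(Z) are analytic functions on
the space of configurations (U, J) …"*.

WHAT IS PROVED HERE (cell `pub-balaban-gaps`, seat ne5 gen 6).  `B13Core214Holomorphic.sepHolOn_core214_sigma` derives the
σ-slot from letters `hR1 ∕ h17a ∕ h17b ∕ hR2 ∕ hR3 ∕ …` uniform on the parameter set; the tree's capstone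
`norm_term214_le_226_of_primitives` derives those SAME letters, pointwise in σ, from PRIMITIVE data — localisation of `G(σ)`,
`Γ₀`, `A(σ)⁻¹`, `C` and (2.16)-type difference bounds `G(σ) − Γ₀`, `A(σ)⁻¹ − C`, `A(σ) − C⁻¹` on located bonds
(`B13Bound226Located.h216R1_of_factors`, `hR1_of_entrywise`, `h17a∕b_of_entrywise`, `hR2_of_entrywise`, `hR3_of_entrywise`,
`entry_bound_mono_rate`, `h216R3_of_diff`, `hdef1_of_linear`, `hdef3_of_linear`).  THIS FILE composes the two:
`sepHolOn_core214_sigma_of_primitives` — the capstone's primitive hypotheses, stated for the σ of the OPEN polydisc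
`{σ | ∀ j, σ j ∈ Uσ}` (print: analyticity on a neighbourhood of the Cauchy contour) together with ENTRYWISE HOLOMORPHY of
`A(σ)` and `G(σ)` there, the last line `F(τ, ·)` measurable with its Gaussian growth (2.20) + (2.22) at the given `τ`, imply
`SepHolOn Uσ (fun σ => core214 A Γ F σ τ)` — the hypothesis `hΨσ` of `norm_term214_le_226_of_primitives` ∕
`B13Lemma3TorusPrimitive.h226_torus_of_primitives`.  (The τ-slot: `B13Core214Holomorphic.sepHolOn_core214_tau`; the single-`U`
shape of `SepHolOn` over-asks in τ — cell record (x8) — so it keeps the uniform (2.20) on the τ-polydisc as a hypothesis.)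

HONEST FRAMING.  Generic finite-dimensional complex analysis over the block model; every kernel family and letter is a
HYPOTHESIS; nothing of Bałaban's `Γ_k(Z₀,σ)`, `C^{(k)}(Z₀,σ)` constructed; (D4) 0∕1, spine 0∕9 UNCHANGED; NOT continuum,
NOT mass gap, NOT Clay.  0 sorry, 0 `def`.
-/

noncomputable section

namespace Literature.MathematicalPhysics.QuantumFieldTheory.Balaban1983to89.B13Core214HolomorphicPrimitive

open Matrix MeasureTheory Finset Complex Metric Set
open scoped Real
open B13PerturbativeStep (WeightHyp)
open B13Term214 (core214 F214 SepHolOn)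
open B13Eq216FirstForm (hdef1_of_linear)
open B13Bound226Primitive (hdef3_of_linear h216R3_of_diff continuous_of_linear)
open B13Bound226Located (h216R1_of_factors hR1_of_entrywise hR2_of_entrywise hR3_of_entrywise h17a_of_entrywise
  h17b_of_entrywise entry_bound_mono_rate Kc_nonneg)
open B13Core214Holomorphic (sepHolOn_core214_sigma)

variable {S : Type*} [DecidableEq S] {ρd : S → S → ℝ} {Kc : ℝ → ℝ}
variable {Λ : Type} [Fintype Λ] [DecidableEq Λ] {C₀ : Type} [Fintype C₀] [DecidableEq C₀]
variable {ι : Type*} [Fintype ι] [DecidableEq ι] {D : Type*}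

/-- **THE σ-SLOT `hΨσ` FROM THE PRIMITIVE OBJECTS.**  Located index set `S` with weight `ρ` and lattice constant `Kc`
(`B13Bound226Located`); bonds of `Z₀` (`Λ`) and of `Z` (`Λ ⊕ C₀`) located with `≤ m` per site; an OPEN `Uσ`; on the open
polydisc `{σ | ∀ j, σ j ∈ Uσ}`: `A(σ)` symmetric with `Re A(σ) ≻ 0` and ENTRYWISE HOLOMORPHIC, the Γ-operator LINEAR with an
entrywise holomorphic kernel `G(σ)`, the localisation letters `K_G, K_Γ, K_{Cσ}, K₀` at rate `κ` and the (2.16)-type difference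
letters `θ_Γ, θ_C, θ_E` (all as in `norm_term214_le_226_of_primitives`, but for the σ of the open polydisc), rates
`κ > κ′ > κ″ > 0`, the common majorant `θ`, `K′θ′ < 1`, `α₅c ≤ ½`, `⟨Γ₀X, CΓ₀X⟩ ≤ g‖X‖²`, `α₅(1 + 2cg) ≤ ½`
(`α₅ = 2θ·mKc(κ″) + a`); the last line `F(τ, ·)` at the given `τ` measurable with `‖F(τ,B)‖ ≤ Ke^{½a‖B‖²}`.
Conclusion: `SepHolOn Uσ (fun σ => core214 A Γ F σ τ)`. [cite: Balaban1988RG2Cluster, (2.14)–(2.15) p.15, (2.16)–(2.22) p.16, (2.23)–(2.25) p.17] -/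
theorem sepHolOn_core214_sigma_of_primitives (hρ : WeightHyp 0 ρd) (hρs : ∀ x y : S, ρd x y = ρd y x)
    (hKc : ∀ b : ℝ, 0 < b → ∀ (T : Finset S) (x : S), ∑ y ∈ T, Real.exp (-(b * ρd x y)) ≤ Kc b)
    (hKc0 : ∀ b : ℝ, 0 < b → 0 ≤ Kc b)
    {Uσ : Set ℂ} (hUσ : IsOpen Uσ)
    (A : (ι → ℂ) → Matrix Λ Λ ℂ) (Γ : (ι → ℂ) → (Λ ⊕ C₀ → ℝ) → (Λ → ℂ)) (G : (ι → ℂ) → Matrix Λ (Λ ⊕ C₀) ℂ)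
    (hAhol : ∀ i j, DifferentiableOn ℂ (fun σ => A σ i j) {σ | ∀ j, σ j ∈ Uσ})
    (hGhol : ∀ i j, DifferentiableOn ℂ (fun σ => G σ i j) {σ | ∀ j, σ j ∈ Uσ})
    (hAs : ∀ σ : ι → ℂ, (∀ j, σ j ∈ Uσ) → (A σ).IsSymm)
    (hA : ∀ σ : ι → ℂ, (∀ j, σ j ∈ Uσ) → ((A σ).map Complex.re).PosDef)
    (hlin : ∀ σ : ι → ℂ, (∀ j, σ j ∈ Uσ) → ∀ X : Λ ⊕ C₀ → ℝ, Γ σ X = G σ *ᵥ fun j => (X j : ℂ))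
    -- the last line at the given τ
    (F : (D → ℂ) → (Λ → ℝ) → ℂ) (τ : D → ℂ) (hFm : StronglyMeasurable (F τ)) {K a : ℝ} (hK : 0 ≤ K) (ha0 : 0 ≤ a)
    (hF : ∀ B, ‖F τ B‖ ≤ K * Real.exp (a / 2 * (B ⬝ᵥ B)))
    -- reference operators
    {C : Matrix Λ Λ ℝ} (hC : C.PosDef) (Γ₀ : Matrix Λ (Λ ⊕ C₀) ℝ)
    -- located bonds
    (locΛ : Λ → S) (locN : Λ ⊕ C₀ → S) {m : ℕ}
    (hfibΛ : ∀ x : S, (Finset.univ.filter fun i => locΛ i = x).card ≤ m)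
    (hfibN : ∀ x : S, (Finset.univ.filter fun j => locN j = x).card ≤ m)
    -- rates and constants
    {kap kap' kap'' θ θE θΓ θC KG KΓ KCs K₀ : ℝ} (hkap'' : 0 < kap'') (h1 : kap'' < kap') (h2 : kap' < kap)
    (hθE : 0 ≤ θE) (hθΓ : 0 ≤ θΓ) (hθC : 0 ≤ θC) (hKG : 0 ≤ KG) (hKΓ : 0 ≤ KΓ) (hKCs : 0 ≤ KCs) (hK₀ : 0 ≤ K₀)
    (hθEle : θE ≤ θ) (hθΓle : θΓ ≤ θ)
    (hθR1le : (m * Kc (kap - kap')) * (m * Kc (kap' - kap''))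
      * (θΓ * KCs * KG + KΓ * θC * KG + KΓ * K₀ * θΓ) ≤ θ)
    -- uniform localisation of the primitive kernels on the open polydisc (L17a)
    (hG : ∀ σ : ι → ℂ, (∀ j, σ j ∈ Uσ) → ∀ b j, ‖G σ b j‖ ≤ KG * Real.exp (-(kap * ρd (locΛ b) (locN j))))
    (hΓ₀ : ∀ b j, ‖Γ₀ b j‖ ≤ KΓ * Real.exp (-(kap * ρd (locΛ b) (locN j))))
    (hCs : ∀ σ : ι → ℂ, (∀ j, σ j ∈ Uσ) →
      ∀ b b', ‖(A σ)⁻¹ b b'‖ ≤ KCs * Real.exp (-(kap * ρd (locΛ b) (locΛ b'))))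
    (hC216 : ∀ b b', ‖C b b'‖ ≤ K₀ * Real.exp (-(kap * ρd (locΛ b) (locΛ b'))))
    -- the (2.16)-type differences on the open polydisc (L16a)
    (hdΓ : ∀ σ : ι → ℂ, (∀ j, σ j ∈ Uσ) →
      ∀ b j, ‖(G σ - Γ₀.map (algebraMap ℝ ℂ)) b j‖ ≤ θΓ * Real.exp (-(kap * ρd (locΛ b) (locN j))))
    (hdC : ∀ σ : ι → ℂ, (∀ j, σ j ∈ Uσ) →
      ∀ b b', ‖((A σ)⁻¹ - C.map (algebraMap ℝ ℂ)) b b'‖ ≤ θC * Real.exp (-(kap * ρd (locΛ b) (locΛ b'))))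
    (hdE : ∀ σ : ι → ℂ, (∀ j, σ j ∈ Uσ) →
      ∀ b b', ‖(A σ - C⁻¹.map (algebraMap ℝ ℂ)) b b'‖ ≤ θE * Real.exp (-(kap * ρd (locΛ b) (locΛ b'))))
    (hsmallKθ : K₀ * (m * Kc kap) * (θ * (m * Kc kap'')) < 1)
    -- the (2.24)–(2.25) smallness (with `a` = the Gaussian growth rate of the last line)
    {c g : ℝ} (hc0 : 0 ≤ c) (hc : ∀ k, hC.1.eigenvalues k ≤ c)
    (hαc : (2 * (θ * (m * Kc kap'')) + a) * c ≤ 1 / 2)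
    (hΓq : ∀ X : Λ ⊕ C₀ → ℝ, (Γ₀ *ᵥ X) ⬝ᵥ (C *ᵥ (Γ₀ *ᵥ X)) ≤ g * (X ⬝ᵥ X))
    (hsmall : (2 * (θ * (m * Kc kap'')) + a) * (1 + 2 * c * g) ≤ 1 / 2) :
    SepHolOn Uσ (fun σ => core214 A Γ F σ τ) := by
  have hθ : 0 ≤ θ := hθE.trans hθEle
  have hkap : 0 < kap := hkap''.trans (h1.trans h2)
  have hkk : kap'' ≤ kap := (h1.trans h2).le
  have hKc'' : 0 ≤ Kc kap'' := hKc0 _ hkap''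
  have hρ0 : 0 ≤ θ * (m * Kc kap'') := mul_nonneg hθ (mul_nonneg (Nat.cast_nonneg m) hKc'')
  -- entrywise (2.16) for R₁(σ), E(σ), R₃(σ) on the open polydisc
  have h216R1 : ∀ σ : ι → ℂ, (∀ j, σ j ∈ Uσ) → ∀ b b',
      ‖(Γ₀ᵀ * C * Γ₀ - ((G σ)ᵀ * (A σ)⁻¹ * G σ).map Complex.re) b b'‖
        ≤ θ * Real.exp (-(kap'' * ρd (locN b) (locN b'))) := fun σ hσ b b' =>
    (h216R1_of_factors hρ hρs hKc hKc0 hθΓ hθC hKG hKΓ hKCs hK₀ hkap''.le h1 h2 locΛ locN hfibΛ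
      (hdΓ σ hσ) (hdC σ hσ) (hG σ hσ) hΓ₀ (hCs σ hσ) hC216 b b').trans
      (mul_le_mul_of_nonneg_right hθR1le (Real.exp_pos _).le)
  have h216E : ∀ σ : ι → ℂ, (∀ j, σ j ∈ Uσ) → ∀ b b',
      ‖(A σ - C⁻¹.map (algebraMap ℝ ℂ)) b b'‖ ≤ θ * Real.exp (-(kap'' * ρd (locΛ b) (locΛ b'))) := fun σ hσ b b' =>
    (entry_bound_mono_rate hρ hθE hkk locΛ locΛ (hdE σ hσ) b b').trans
      (mul_le_mul_of_nonneg_right hθEle (Real.exp_pos _).le)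
  have h216R3 : ∀ σ : ι → ℂ, (∀ j, σ j ∈ Uσ) → ∀ i j,
      ‖((G σ).map Complex.re - Γ₀) i j‖ ≤ θ * Real.exp (-(kap'' * ρd (locΛ i) (locN j))) := fun σ hσ i j => by
    have hmono : ∀ i j, ‖(G σ - Γ₀.map (algebraMap ℝ ℂ)) i j‖ ≤ θ * Real.exp (-(kap'' * ρd (locΛ i) (locN j))) :=
      fun i j => (entry_bound_mono_rate hρ hθΓ hkk locΛ locN (hdΓ σ hσ) i j).trans
        (mul_le_mul_of_nonneg_right hθΓle (Real.exp_pos _).le)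
    exact h216R3_of_diff hmono i j
  -- the Γ-entries are holomorphic: Γ σ X i = Σ_j G σ i j X_j
  have hΓd : ∀ (X : Λ ⊕ C₀ → ℝ) (i : Λ), DifferentiableOn ℂ (fun σ => Γ σ X i) {σ | ∀ j, σ j ∈ Uσ} := by
    intro X i
    have e : ∀ σ ∈ {σ : ι → ℂ | ∀ j, σ j ∈ Uσ}, Γ σ X i = ∑ j, G σ i j * (X j : ℂ) := fun σ hσ => by
      rw [hlin σ hσ X]; rfl
    exact (DifferentiableOn.fun_sum fun j _ => (hGhol i j).mul (differentiableOn_const _)).congr e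
  refine sepHolOn_core214_sigma (Γ₀ := Γ₀) (ρ := θ * (m * Kc kap''))
    (η := K₀ * (m * Kc kap) * (θ * (m * Kc kap'')) * (1 + (1 - K₀ * (m * Kc kap) * (θ * (m * Kc kap'')))⁻¹) / 2)
    hUσ τ hAhol hAs hA hΓd (fun σ hσ => continuous_of_linear (G σ) (Γ σ) (hlin σ hσ)) hFm hC hρ0 ha0 hK
    (fun σ hσ X => ?_) (fun σ hσ => ?_) (fun σ hσ => ?_) (fun σ hσ B => ?_) (fun σ hσ X B => ?_) hF hc0 hc hαc hΓq
    (lt_of_le_of_lt hsmall (by norm_num))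
  · exact hR1_of_entrywise hρ hρs hKc (Γ σ) Γ₀ _ hθ hkap'' locN hfibN
      (hdef1_of_linear (A σ) (G σ) (Γ σ) (hlin σ hσ) C Γ₀) (h216R1 σ hσ) X
  · exact h17a_of_entrywise hρ hρs hKc hC (hA σ hσ) hθ hkap'' hK₀ hkap locΛ hfibΛ hC216 (h216E σ hσ) hsmallKθ
  · exact h17b_of_entrywise hρ hρs hKc hC (hA σ hσ) hθ hkap'' hK₀ hkap locΛ hfibΛ hC216 (h216E σ hσ) hsmallKθ
  · exact hR2_of_entrywise hρ hρs hKc hθ hkap'' locΛ hfibΛ (h216E σ hσ) B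
  · exact hR3_of_entrywise hρs hKc (Γ σ) Γ₀ _ hθ hkap'' locΛ locN hfibΛ hfibN
      (hdef3_of_linear (G σ) (Γ σ) (hlin σ hσ) Γ₀) (h216R3 σ hσ) X B

end Literature.MathematicalPhysics.QuantumFieldTheory.Balaban1983to89.B13Core214HolomorphicPrimitive

end
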